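import Literature.NumberTheory.EllipticCurves.OpenImageMazurTwistProofs
import Literature.NumberTheory.EllipticCurves.TateModuleTwistTransportProofs
import Literature.NumberTheory.EllipticCurves.VariableChangePointsMap
import Literature.NumberTheory.EllipticCurves.QuadraticBaseChangeGaloisProofs
import Literature.NumberTheory.EllipticCurves.QuadraticTwistPadicReduction
import HarnessLib

/-!
# Quadratic twists preserve irreducibility of `E[p]` as a Galois module — over any field with
# `2 ≠ 0`, and for the base change to a number field of a twist defined over `ℚ` (proofs only)

A *proofs* file (theorems only: no definition, no named fact, no instance, no `sorry`) written by the
typer seat `bsd-littype-01` (gen 8) of the cross-ladder literature-typing layer (D-0088(4); cell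
`run/shared/lean/pub/bsd-littype/`), as the tree lemma needed by the kernel replay of the
quadratic-twist clauses of Burungale–Skinner–Tian–Wan arXiv:2409.01350v2 Thm. 10.10 (b)
(`BurungaleSkinnerTianWan2024/OrdinaryTwoVariableMainStatementTwistReplayProofs.lean`): the refereed
two-variable inputs over an imaginary quadratic field `L` (Yan–Zhu 2026 Cor. 2.9 / Lemma 5.3, BCS25
Thm. 4.1.3, …) ask "`ρ̄_E|_{G_L}` irreducible" of the curve they are applied to, and for a twisted curve
`E₀^{(d)}` this has to be derived from the same property of `E₀`.

* `hasIrreducibleModPGaloisRep_of_smul_eq_quadraticTwist_of_field` — over ANY field `K` with `2 ≠ 0`: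
  if `C • W_d = W^{(d)}` (`d ≠ 0`) and `E[p]` (the `p`-torsion of `W(K̄)` with its `G_K`-action,
  `WeierstrassCurve.HasIrreducibleModPGaloisRep`) has no `G_K`-stable subgroup other than `⊥`, `⊤`, then
  neither has `E^{(d)}[p]`. Proof (Silverman AEC X.5 Cor. 5.4, X.2 Prop. 2.4): the twist isomorphism
  `F : E^{(d)}(K̄) ≃+ E(K̄)` — the tree's `exists_addEquiv_geomPoints_quadraticTwist_signed` composed with
  the change of variables `C` (`VariableChange.pointEquivBaseChange`, `Affine.Point.congrEquiv`) —
  satisfies `F(σP) = ±σF(P)`, so it carries `G_K`-stable subgroups of `E^{(d)}[p]` to `G_K`-stable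
  subgroups of `E[p]` (a sign does not move a subgroup). The tree's
  `Rank1Residual.not_hasIrreducibleModPGaloisRep_twist` is the case `K = ℚ` (proved there via rational
  lines); this file does not touch it.
* `map_smul_baseChange_eq_quadraticTwist_baseChange` — base change to `K` of `C • W = W₀^{(d)}` over `ℚ`
  (`VariableChange.baseChange_smul_eq` + `map_quadraticTwist`).
* `hasIrreducibleModPGaloisRep_baseChange_of_smul_eq_quadraticTwist` — for `C • W = W₀^{(d)}` over `ℚ`
  and a number field `K`: `E₀[p]` irreducible as a `G_K`-module ⟹ `E₀^{(d)}[p]` irreducible as a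
  `G_K`-module.

## References
* [SilvermanAEC2009] J. H. Silverman, *The Arithmetic of Elliptic Curves*, 2nd ed., X.5 Cor. 5.4 and
  X.2 Prop. 2.4 (the twist isomorphism over `K(√d)` and its Galois behaviour).
-/

noncomputable section

open scoped Classical

open Field WeierstrassCurve Literature.NumberTheory.GaloisRepresentations
  Literature.NumberTheory.EllipticCurves

namespace Literature.NumberTheory.EllipticCurves

/-! ## §1. Quadratic twists preserve irreducibility of `E[p]`, over any field with `2 ≠ 0` -/

/-- **Irreducibility of `E[p]` as a `G_K`-module passes to quadratic twists, over any field `K` with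
`2 ≠ 0`.** If `C • W_d = W^{(d)}` (`d ≠ 0`) and every `G_K`-stable subgroup of `E[p]` is trivial or
everything, then the same holds for `E^{(d)}[p]`: along the twist isomorphism
`F : E^{(d)}(K̄) ≃+ E(K̄)`, which satisfies `F(σP) = ±σF(P)` for every `σ ∈ G_K` (Silverman AEC X.5
Cor. 5.4; tree `exists_addEquiv_geomPoints_quadraticTwist_signed`, composed with the change of
variables `C`), the image of a `G_K`-stable subgroup of `E^{(d)}[p]` is a `G_K`-stable subgroup of `E[p]`
(a sign does not move a subgroup). The tree's `Rank1Residual.not_hasIrreducibleModPGaloisRep_twist` is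
the case `K = ℚ` (via rational lines); this is the field-general form needed over an imaginary
quadratic `L`. [cite: SilvermanAEC2009, X.5 Cor. 5.4 and X.2 Prop. 2.4] -/
theorem hasIrreducibleModPGaloisRep_of_smul_eq_quadraticTwist_of_field {K : Type*} [Field K]
    [NeZero (2 : K)] (W Wd : WeierstrassCurve K) {d : K} (hd : d ≠ 0) (C : VariableChange K)
    (hC : C • Wd = W.quadraticTwist d) {p : ℕ} (hirr : W.HasIrreducibleModPGaloisRep p) :
    Wd.HasIrreducibleModPGaloisRep p := by
  -- the twist isomorphism, equivariant up to sign
  obtain ⟨f, hf⟩ := W.exists_addEquiv_geomPoints_quadraticTwist_signed hd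
  let e₁ : Wd.geomPoints ≃+ (C • Wd).geomPoints :=
    VariableChange.pointEquivBaseChange Wd C (AlgebraicClosure K)
  let e₂ : (C • Wd).geomPoints ≃+ (W.quadraticTwist d).geomPoints :=
    Affine.Point.congrEquiv (congrArg (fun Z : WeierstrassCurve K ↦ Z.baseChange (AlgebraicClosure K)) hC)
  have h₁ : ∀ (σ : absoluteGaloisGroup K) (P : Wd.geomPoints), e₁ (σ • P) = σ • e₁ P := fun σ P ↦
    VariableChange.pointEquivBaseChange_map_algEquiv Wd C (absoluteGaloisGroup.toAlgEquiv K σ) P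
  have h₂ : ∀ (σ : absoluteGaloisGroup K) (P : (C • Wd).geomPoints), e₂ (σ • P) = σ • e₂ P :=
    fun σ P ↦ congrEquiv_smul_of_eq hC (absoluteGaloisGroup.toAlgEquiv K σ) P
  set F : Wd.geomPoints ≃+ W.geomPoints := (e₁.trans e₂).trans f with hF
  have hFsign : ∀ (σ : absoluteGaloisGroup K) (P : Wd.geomPoints),
      F (σ • P) = σ • F P ∨ F (σ • P) = -(σ • F P) := by
    intro σ P
    rcases hf σ with hσ | hσ
    · left
      simp only [hF, AddEquiv.trans_apply, h₁, h₂, hσ]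
    · right
      simp only [hF, AddEquiv.trans_apply, h₁, h₂, hσ]
  -- restriction to `p`-torsion, a bijection
  have hmem : ∀ T : geomTorsion Wd (p : ℤ), F T ∈ geomTorsion W (p : ℤ) := by
    intro T
    rw [AddSubgroup.torsionBy.nsmul_iff, ← map_nsmul, AddSubgroup.torsionBy.nsmul_iff.mp T.2,
      map_zero]
  let φ : geomTorsion Wd (p : ℤ) →+ geomTorsion W (p : ℤ) :=
    AddMonoidHom.codRestrict ((F : Wd.geomPoints →+ W.geomPoints).comp
      (geomTorsion Wd (p : ℤ)).subtype) (geomTorsion W (p : ℤ)) hmem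
  have hφ : ∀ T, ((φ T : geomTorsion W (p : ℤ)) : W.geomPoints) = F T := fun T ↦ rfl
  have hφinj : Function.Injective φ := by
    intro T₁ T₂ h
    have h' := congrArg (fun S : geomTorsion W (p : ℤ) ↦ (S : W.geomPoints)) h
    simp only [hφ] at h'
    exact Subtype.ext (F.injective h')
  have hφsurj : Function.Surjective φ := by
    intro S
    have hS : F.symm S ∈ geomTorsion Wd (p : ℤ) := by
      rw [AddSubgroup.torsionBy.nsmul_iff]
      apply F.injective
      rw [map_nsmul, AddEquiv.apply_symm_apply, map_zero]
      exact AddSubgroup.torsionBy.nsmul_iff.mp S.2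
    refine ⟨⟨F.symm S, hS⟩, Subtype.ext ?_⟩
    rw [hφ]
    exact F.apply_symm_apply S
  let eφ : geomTorsion Wd (p : ℤ) ≃+ geomTorsion W (p : ℤ) := AddEquiv.ofBijective φ ⟨hφinj, hφsurj⟩
  have heφ : ∀ T, eφ T = φ T := fun T ↦ rfl
  have hφsign : ∀ (σ : absoluteGaloisGroup K) (T : geomTorsion Wd (p : ℤ)),
      φ (σ • T) = σ • φ T ∨ φ (σ • T) = -(σ • φ T) := by
    intro σ T
    rcases hFsign σ T with h | h
    · left
      exact Subtype.ext (by rw [AddSubgroup.torsionBy.coe_smul, hφ, hφ,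
        AddSubgroup.torsionBy.coe_smul, h])
    · right
      exact Subtype.ext (by rw [AddSubgroup.coe_neg, AddSubgroup.torsionBy.coe_smul, hφ, hφ,
        AddSubgroup.torsionBy.coe_smul, h])
  -- transport of a `G_K`-stable subgroup of `E^{(d)}[p]` to one of `E[p]`
  intro H hH
  let H' : AddSubgroup (geomTorsion W (p : ℤ)) := H.map eφ.toAddMonoidHom
  have hmemH' : ∀ S, S ∈ H' ↔ eφ.symm S ∈ H := fun S ↦ by rw [AddSubgroup.mem_map_equiv]
  have hstab : ∀ (σ : absoluteGaloisGroup K), ∀ S ∈ H', σ • S ∈ H' := by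
    intro σ S hS
    rw [hmemH'] at hS ⊢
    have hS' : eφ (eφ.symm S) = S := eφ.apply_symm_apply S
    rcases hφsign σ (eφ.symm S) with h | h
    · have e1 : eφ (σ • eφ.symm S) = σ • S := by rw [heφ, h, ← heφ, hS']
      rw [← e1, AddEquiv.symm_apply_apply]
      exact hH σ _ hS
    · have e1 : eφ (-(σ • eφ.symm S)) = σ • S := by rw [map_neg, heφ, h, ← heφ, hS', neg_neg]
      rw [← e1, AddEquiv.symm_apply_apply]
      exact H.neg_mem (hH σ _ hS)
  rcases hirr H' hstab with hbot | htop
  · left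
    rw [eq_bot_iff]
    intro T hT
    have hT' : eφ T ∈ H' := by rw [hmemH', AddEquiv.symm_apply_apply]; exact hT
    rw [hbot, AddSubgroup.mem_bot] at hT'
    rw [AddSubgroup.mem_bot]
    exact (map_eq_zero_iff eφ eφ.injective).mp hT'
  · right
    rw [eq_top_iff]
    intro T _
    have hT' : eφ T ∈ H' := by rw [htop]; exact AddSubgroup.mem_top _
    rw [hmemH', AddEquiv.symm_apply_apply] at hT'
    exact hT'

/-! ## §2. Base change of a `ℚ`-isomorphism with a twist; (irr_L) for `E₀^{(d)}` from (irr_L) for `E₀` -/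

/-- The base change to `K` of `C • W = W₀^{(d)}` over `ℚ`: `C_K • W_K = (W₀)_K^{(d)}`
(`baseChange_smul_eq`, `map_quadraticTwist`): the twist `⟨0, d b₂/4, 0, d² b₄/2, d³ b₆/4⟩` and the
change of variables are given by universal formulas, which commute with `ℚ → K`.
[cite: SilvermanAEC2009, X.5 Cor. 5.4 with X.2 Prop. 2.4 (bookkeeping: base change of the twist datum)] -/
theorem map_smul_baseChange_eq_quadraticTwist_baseChange {W₀ W : WeierstrassCurve ℚ} {d : ℚ}
    {C : VariableChange ℚ} (hC : C • W = W₀.quadraticTwist d) (K : Type) [Field K] [NumberField K] :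
    C.map (algebraMap ℚ K) • W.baseChange K = (W₀.baseChange K).quadraticTwist (algebraMap ℚ K d) := by
  rw [← VariableChange.baseChange_smul_eq, hC]
  exact W₀.map_quadraticTwist (algebraMap ℚ K) d

/-- **(irr_L) passes from `E₀` to its quadratic twists**: if `C • W = W₀^{(d)}` over `ℚ` (`d ≠ 0`) and
`E₀[p]` is an irreducible `G_K`-module (`K` a number field), so is `E₀^{(d)}[p]` — §1 over `K` for the
base-changed isomorphism. [cite: SilvermanAEC2009, X.5 Cor. 5.4] -/
theorem hasIrreducibleModPGaloisRep_baseChange_of_smul_eq_quadraticTwist {W₀ W : WeierstrassCurve ℚ}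
    {d : ℚ} (hd : d ≠ 0) {C : VariableChange ℚ} (hC : C • W = W₀.quadraticTwist d) (K : Type)
    [Field K] [NumberField K] {p : ℕ} (h : (W₀.baseChange K).HasIrreducibleModPGaloisRep p) :
    (W.baseChange K).HasIrreducibleModPGaloisRep p := by
  haveI : NeZero (2 : K) := ⟨two_ne_zero⟩
  have hdK : algebraMap ℚ K d ≠ 0 := by simpa using hd
  exact hasIrreducibleModPGaloisRep_of_smul_eq_quadraticTwist_of_field (W₀.baseChange K)
    (W.baseChange K) hdK (C.map (algebraMap ℚ K)) (map_smul_baseChange_eq_quadraticTwist_baseChange hC K) h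

end Literature.NumberTheory.EllipticCurves

end
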